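import Summits.HubbardSuperconductivity.HubbardSuperconductivity.Theorems.AnisotropyChordTransferFibre3N1RowCellSound

/-!
# Route `AnisotropyChord` / H0 rotor rung, LEVEL 2 row `N₁`: the `ν`-column `[239, 275]/10⁶` — named-sum brackets

The `ν`-cell `ν = λ₂/θ² ∈ [0.000239, 0.000275]` of the ∀L ≥ 128 kernel certificate of the (KT-1″) trial-gap bound: the twelve
L-uniform named-sum brackets (`colN00239` : `L2.NamedCell`, `T = 241/10⁵ ≥ θ₀²`, rounding denominator `10⁶`) and their kernel
certificate ★ `colN00239_check : colN00239.check = true` (integer B1 evaluator of p2 g4, one `decide`, ≈ 2 min); shared by all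
`a`-cells of this column (files `…N1RowL2N00239A….lean`).  Generated by p2 g5's cells/mkfiles.py (HOME/hubbard-h0-rotor-p2/cells/).
Prover seat `hubbard-h0-rotor-p2` g5; helper for piece A = stmt-HubbardSuperconductivity-23918 of rung 19089
(`--supports`, helper class).  Nothing here proves superconductivity in the Hubbard model; one kernel-certified piece of ONE
conditional reduction (the GM₃ ∀L certificate, Level-2 row `N₁`); the rotor TARGET as originally worded stays FALSE (g15 verdict).
Mathlib + the tree only; no sorry.
-/

set_option linter.dupNamespace false
set_option autoImplicit false

open Literature.Analysis.ValidatedNumerics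

namespace Summit.HubbardSuperconductivity.HubbardSuperconductivity.Theorems.AnisotropyChord.Transfer.Fibre3.L2.N1

/-- the column data: `ν`-cell `[239, 275]/10⁶` and the twelve certified brackets of
`θ⁴S₂, θ⁶S₃, θ⁸S₄, θ⁴T10, θ⁴T11, θ⁶G21, θ⁶G12, θ⁸G22, θ⁸G31, θ⁸G13, θ⁴Tx(1,0), θ⁴Tx(1,1)`. -/
def colN00239 : L2.NamedCell :=
  { n1 := 239,
    n2 := 275,
    νd := 1000000,
    Tn := 241,
    Td := 100000,
    D := 1000000,
    bS2 := (75307/12500, 6055774191/1000000000),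
    bS3 := (72839/15625, 4669598321/1000000000),
    bS4 := (66958/15625, 67088189/15625000),
    bT10 := (46327/12500, 233698477/62500000),
    bT11 := (205259/50000, 258662477/62500000),
    bG21 := (2058863/1000000, 413018513/200000000),
    bG12 := (2058863/1000000, 413018513/200000000),
    bG22 := (591543/500000, 1188546141/1000000000),
    bG31 := (1593689/1000000, 1599575141/1000000000),
    bG13 := (1593689/1000000, 1599575141/1000000000),
    bTx10 := (229470523/62500000, 233698477/62500000),
    bTx11 := (63606787/15625000, 258662477/62500000) }

/-- ★ the named-sum brackets of the column hold (kernel evaluation of the integer B1 certificate). -/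
theorem colN00239_check : colN00239.check = true := by decide +kernel

end Summit.HubbardSuperconductivity.HubbardSuperconductivity.Theorems.AnisotropyChord.Transfer.Fibre3.L2.N1
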